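import Summits.AtomisticToContinuum.Crystallization.Theorems.LoopTunnelDialCalibratorRung

/-!
# LoopTunnelDial — the CALIBRATOR RUNG, part 2 (§3–§6): calibrated voids are improvements at every level, the μ-seat, the landed
# caged/credited classes inside the calibrated class, and Kossel's half-environment principle (lens-5 generation 24; crux `PocketCase`,
# stmt-AtomisticToContinuum-27294).  Second half of kit 12 `LoopTunnelDialCalibratorRung.lean`, split for the 400-line landing lint; §1–§2b
# (docking, surface floor, the two laws, the staircase form) are the tree module `LoopTunnelDialCalibratorRung`.  All `[folklore]`; 0 sorry.
-/


open scoped BigOperators Classical Topology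
open Filter
open Literature.MathematicalPhysics.StatisticalMechanics
open Summit.AtomisticToContinuum.Crystallization.Theorems.GrainPercolationDialCrossCeiling (E3)
open Summit.AtomisticToContinuum.Crystallization.Theorems.LoopTunnelDialLocalSurgery
open Summit.AtomisticToContinuum.Crystallization.Theorems.LoopTunnelDialVoidRung
open Summit.AtomisticToContinuum.Crystallization.Theorems.LoopTunnelDialVoidRungCredit (two_mul_interactionEnergy_le_neg_credit
  cross_le_neg_credit)
open Summit.AtomisticToContinuum.Crystallization.Theorems.LoopTunnelDialRangeTails (farIdx nearIdx tailE sum_erase_eq_near_add_far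
  sum_far_abs_lennardJones_le)

namespace Summit.AtomisticToContinuum.Crystallization.Theorems.LoopTunnelDialCalibratorRung

variable {N : ℕ}

/-! ## §3 A calibrated void is a local improvement at EVERY level (the NEAR♯ currency) -/

/-- **A CALIBRATED `k`-VOID is a radius-`R` improvement about SOME particle (PROVED, GS-free, every level `e`):** hole points
`q : Fin k → E3`, `1 ≤ k ≤ ⌈64R³⌉`, within `R` of `y c`, `9/10`-clear of all particles, pairwise `9/10` apart, and a particle `m` with
`k·(1/100 − 𝓔^m(y)) + 1/50 ≤ fillGain(q, y)`; then `y` is radius-`R` improvable by `1/100` at level `e` in the landed local-surgery currency —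
about `m` (delete it) when `𝓔^m(y) ≥ e + 1/100`, about `c` (fill the void) otherwise. -/
theorem improvable_of_calibratedVoid {y : Fin N → E3} (hy : Function.Injective y) {R : ℝ} (hR : 0 < R) {c : Fin N}
    {k : ℕ} {q : Fin k → E3} (hk : 1 ≤ k) (hkR : k ≤ ⌈64 * R ^ 3⌉₊)
    (hqc : ∀ i : Fin k, dist (q i) (y c) ≤ R) (hclear : ∀ (i : Fin k) (m : Fin N), 9 / 10 ≤ dist (q i) (y m))
    (hsep : ∀ i l : Fin k, i ≠ l → 9 / 10 ≤ dist (q i) (q l)) {m : Fin N}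
    (hcal : k * (1 / 100 - siteEnergy lennardJones y m) + 1 / 50 ≤
      -(interactionEnergy lennardJones q + ∑ i : Fin k, ∑ l : Fin N, lennardJones (dist (q i) (y l))))
    (e : ℝ) :
    ∃ c' : Fin N, ∃ (M : ℕ) (z : Fin M → E3), Function.Injective z ∧
      (∀ m' : Fin N, R < dist (y m') (y c') → y m' ∈ Set.range z) ∧
      (∀ l : Fin M, R < dist (z l) (y c') → z l ∈ Set.range y) ∧
      N ≤ M + ⌈64 * R ^ 3⌉₊ ∧ M ≤ N + ⌈64 * R ^ 3⌉₊ ∧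
      interactionEnergy lennardJones z + 1 / 100 ≤ interactionEnergy lennardJones y + e * ((M : ℝ) - N) := by
  by_cases hloose : e + 1 / 100 ≤ siteEnergy lennardJones y m
  · -- delete the calibrator
    exact ⟨m, improvable_of_le_siteEnergy hy hR (by rw [dist_self]; exact hR.le) hloose⟩
  · -- fill the void
    push Not at hloose
    have hqinj : Function.Injective q := by
      intro i l h
      by_contra hil
      have h' := hsep i l hil
      rw [h, dist_self] at h'
      norm_num at h'
    have hdisj : ∀ (i : Fin k) (m : Fin N), q i ≠ y m := by
      intro i m h
      have h' := hclear i m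
      rw [h, dist_self] at h'
      norm_num at h'
    have hinj : Function.Injective (Fin.append q y) := Fin.append_injective_iff.2 ⟨hqinj, hy, hdisj⟩
    refine ⟨c, k + N, Fin.append q y, hinj, fun m' _ => ⟨Fin.natAdd k m', Fin.append_right q y m'⟩, fun l hl => ?_,
      by omega, by omega, ?_⟩
    · revert hl
      refine Fin.addCases (motive := fun l => R < dist (Fin.append q y l) (y c) → Fin.append q y l ∈ Set.range y)
        (fun i hi => ?_) (fun m' _ => ?_) l
      · rw [Fin.append_left] at hi
        exact absurd (hqc i) (not_le.2 hi)
      · exact ⟨m', (Fin.append_right q y m').symm⟩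
    · have hE := interactionEnergy_append lennardJones lennardJones_zero q y
      have hcast : e * (((k + N : ℕ) : ℝ) - (N : ℝ)) = e * k := by push_cast; ring
      rw [hcast, hE]
      have hk' : (1 : ℝ) ≤ k := by exact_mod_cast hk
      have hk0 : (0 : ℝ) ≤ k := by linarith
      -- `k (1/100 − 𝓔^m) > k (1/100 − e − 1/100) = −e k`
      have h1 : k * (1 / 100 - siteEnergy lennardJones y m) ≥ k * (-e) := by
        exact mul_le_mul_of_nonneg_left (by linarith) hk0
      linarith

/-- **THE CALIBRATOR RUNG OF THE NEAR SURGERY FLOOR (PROVED, GS-free, sequence level, EVERY level):** for every sequence of injective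
configurations, margin `1/100`, from radius `1` on, at every index: a calibrated void within `R` of some particle makes the configuration
radius-`R` improvable by `1/100` about some particle — the line's `FloorEvI x trig` conclusion for the sub-trigger «calibrated void». -/
theorem calibrator_floor (x : (N : ℕ) → (Fin N → E3)) (hx : ∀ N, Function.Injective (x N)) :
    ∃ η : ℝ, 0 < η ∧ ∃ R₁ : ℝ, ∀ e R : ℝ, R₁ ≤ R → ∀ N : ℕ,
      (∃ (c : Fin N) (k : ℕ) (q : Fin k → E3) (m : Fin N), 1 ≤ k ∧ (∀ i : Fin k, dist (q i) (x N c) ≤ R) ∧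
          (∀ (i : Fin k) (l : Fin N), 9 / 10 ≤ dist (q i) (x N l)) ∧ (∀ i l : Fin k, i ≠ l → 9 / 10 ≤ dist (q i) (q l)) ∧
          (k : ℝ) * (1 / 100 - siteEnergy lennardJones (x N) m) + 1 / 50 ≤
            -(interactionEnergy lennardJones q + ∑ i : Fin k, ∑ l : Fin N, lennardJones (dist (q i) (x N l)))) →
        ∃ (c : Fin N) (M : ℕ) (z : Fin M → E3), Function.Injective z ∧
          (∀ k : Fin N, R < dist (x N k) (x N c) → x N k ∈ Set.range z) ∧
          (∀ l : Fin M, R < dist (z l) (x N c) → z l ∈ Set.range (x N)) ∧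
          N ≤ M + ⌈64 * R ^ 3⌉₊ ∧ M ≤ N + ⌈64 * R ^ 3⌉₊ ∧
          interactionEnergy lennardJones z + η ≤ interactionEnergy lennardJones (x N) + e * ((M : ℝ) - N) := by
  refine ⟨1 / 100, by norm_num, 1, fun e R hR N => ?_⟩
  rintro ⟨c, k, q, m, hk, hqc, hclear, hsep, hcal⟩
  exact improvable_of_calibratedVoid (hx N) (by linarith) hk (holes_card_le hR hqc hsep) hqc hclear hsep hcal e

/-! ## §4 The μ-seat: μ-rigid configurations carry no calibrated void (ANY level) -/

/-- **NO CALIBRATED VOID AT A μ-STABLE CONFIGURATION (PROVED, GS-free, every level):** at an injective configuration that is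
`(e, 1/(j+1), j)`-μ-stable with `100 ≤ j`, every particle `m` and every injective hole family `q` off the particles with `1 ≤ k ≤ j` satisfy
`fillGain(q, y) < k·(1/100 − 𝓔^m(y)) + 1/50`. -/
theorem fillGain_lt_of_muStable {e : ℝ} {j : ℕ} (hj : 100 ≤ j) {y : Fin N → E3} (hy : Function.Injective y)
    (hM : ∀ M : ℕ, N ≤ M + j → M ≤ N + j → ∀ z : Fin M → E3, Function.Injective z →
      interactionEnergy lennardJones y + e * ((M : ℝ) - N) - 1 / ((j : ℝ) + 1) ≤ interactionEnergy lennardJones z)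
    {k : ℕ} (hk : 1 ≤ k) (hkj : k ≤ j) {q : Fin k → E3} (hq : Function.Injective q)
    (hdisj : ∀ (i : Fin k) (m : Fin N), q i ≠ y m) (m : Fin N) :
    -(interactionEnergy lennardJones q + ∑ i : Fin k, ∑ l : Fin N, lennardJones (dist (q i) (y l))) <
      k * (1 / 100 - siteEnergy lennardJones y m) + 1 / 50 := by
  have h := fillGain_le_of_muStable hM hy hk hkj hq hdisj m
  have hε : 1 / ((j : ℝ) + 1) < 1 / 100 := by
    have hj' : (100 : ℝ) ≤ j := by exact_mod_cast hj
    rw [div_lt_div_iff₀ (by positivity) (by norm_num)]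
    linarith
  have hk' : (1 : ℝ) ≤ k := by exact_mod_cast hk
  have hmono : (k : ℝ) * (1 / ((j : ℝ) + 1) - siteEnergy lennardJones y m) ≤ k * (1 / 100 - siteEnergy lennardJones y m) :=
    mul_le_mul_of_nonneg_left (by linarith) (by linarith)
  linarith

/-- **μ-SEAT OF THE CALIBRATOR RUNG (PROVED, GS-free) — the line's `RigidNearPocket0` on the calibrated-void class, at EVERY test radius,
EVERY index and EVERY level:** along any sequence of injective configurations, for every `R ≥ 1` and every `e`, at the order
`j₀ = max ⌈64R³⌉ 100`, an `(e, 1/(j₀+1), j₀)`-μ-stable `x N` carries NO calibrated void within `R` of any particle. -/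
theorem rigid_calibratedVoid_seat (x : (N : ℕ) → (Fin N → E3)) (hx : ∀ N, Function.Injective (x N)) :
    ∀ R : ℝ, 1 ≤ R → ∀ e : ℝ, ∃ j₀ : ℕ, ∀ N : ℕ,
      (∀ M : ℕ, N ≤ M + j₀ → M ≤ N + j₀ → ∀ z : Fin M → E3, Function.Injective z →
        interactionEnergy lennardJones (x N) + e * ((M : ℝ) - N) - 1 / ((j₀ : ℝ) + 1) ≤ interactionEnergy lennardJones z) →
      ¬ ∃ (c : Fin N) (k : ℕ) (q : Fin k → E3) (m : Fin N), 1 ≤ k ∧ (∀ i : Fin k, dist (q i) (x N c) ≤ R) ∧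
          (∀ (i : Fin k) (l : Fin N), 9 / 10 ≤ dist (q i) (x N l)) ∧ (∀ i l : Fin k, i ≠ l → 9 / 10 ≤ dist (q i) (q l)) ∧
          (k : ℝ) * (1 / 100 - siteEnergy lennardJones (x N) m) + 1 / 50 ≤
            -(interactionEnergy lennardJones q + ∑ i : Fin k, ∑ l : Fin N, lennardJones (dist (q i) (x N l))) := by
  intro R hR e
  refine ⟨max ⌈64 * R ^ 3⌉₊ 100, fun N hM => ?_⟩
  rintro ⟨c, k, q, m, hk, hqc, hclear, hsep, hcal⟩
  have hqinj : Function.Injective q := by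
    intro i l h
    by_contra hil
    have h' := hsep i l hil
    rw [h, dist_self] at h'
    norm_num at h'
  have hdisj : ∀ (i : Fin k) (m : Fin N), q i ≠ x N m := by
    intro i m h
    have h' := hclear i m
    rw [h, dist_self] at h'
    norm_num at h'
  have hkR := holes_card_le hR hqc hsep
  have h := fillGain_lt_of_muStable (le_max_right _ _) (hx N) hM hk (le_trans hkR (le_max_left _ _)) hqinj hdisj m
  linarith

/-! ## §5 The landed caged-void and credited-void classes are inside the calibrated class (given one particle bound by at most `0.77` / `0.766`) -/

/-- **CAGED ⟹ CALIBRATED (PROVED, GS-free):** a caged void (`20k ≤ 2P + D`, the class of `LoopTunnelDialVoidRung`) together with ANY particle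
`m` with `𝓔^m(y) ≥ −77/100` satisfies the calibrated inequality (`fillGain ≥ (1/25)(2P + D) ≥ (4/5)k ≥ (78/100)k + 1/50`). -/
theorem calibrated_of_caged {y : Fin N → E3} {k : ℕ} {q : Fin k → E3} (hk : 1 ≤ k)
    (hclear : ∀ (i : Fin k) (m : Fin N), 9 / 10 ≤ dist (q i) (y m))
    (hsep : ∀ i l : Fin k, i ≠ l → 9 / 10 ≤ dist (q i) (q l))
    (hcount : 20 * k ≤
      2 * ∑ i : Fin k, (Finset.univ.filter fun m : Fin N => 39 / 40 ≤ dist (q i) (y m) ∧ dist (q i) (y m) ≤ 103 / 100).card +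
        ∑ i : Fin k, ((Finset.univ.erase i).filter fun l : Fin k => 39 / 40 ≤ dist (q i) (q l) ∧ dist (q i) (q l) ≤ 103 / 100).card)
    {m : Fin N} (hm : -(77 / 100 : ℝ) ≤ siteEnergy lennardJones y m) :
    k * (1 / 100 - siteEnergy lennardJones y m) + 1 / 50 ≤
      -(interactionEnergy lennardJones q + ∑ i : Fin k, ∑ l : Fin N, lennardJones (dist (q i) (y l))) := by
  have hself := two_mul_interactionEnergy_le_of_sep q hsep
  have hcross := cross_le_of_clear q y hclear
  have hcount' : (20 : ℝ) * k ≤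
      2 * ((∑ i : Fin k, (Finset.univ.filter fun m : Fin N =>
        39 / 40 ≤ dist (q i) (y m) ∧ dist (q i) (y m) ≤ 103 / 100).card : ℕ) : ℝ) +
      ((∑ i : Fin k, ((Finset.univ.erase i).filter fun l : Fin k =>
        39 / 40 ≤ dist (q i) (q l) ∧ dist (q i) (q l) ≤ 103 / 100).card : ℕ) : ℝ) := by
    exact_mod_cast hcount
  have hk' : (1 : ℝ) ≤ k := by exact_mod_cast hk
  have h1 : k * (1 / 100 - siteEnergy lennardJones y m) ≤ k * (78 / 100) :=
    mul_le_mul_of_nonneg_left (by linarith) (by linarith)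
  linarith

/-- **CREDITED ⟹ CALIBRATED (PROVED, GS-free):** a credited void (`2(B·k + 1/100) ≤ 2P_w + D_w` for a certified credit `w`, the class of the landed
`LoopTunnelDialVoidRungCredit`, `B = 98309653/125000000`) together with ANY particle `m` with `𝓔^m(y) ≥ −B + 1/50` (`= −0.76647722`) satisfies
the calibrated inequality. -/
theorem calibrated_of_credited {y : Fin N → E3} {k : ℕ} {q : Fin k → E3} (hk : 1 ≤ k)
    (hclear : ∀ (i : Fin k) (m : Fin N), 9 / 10 ≤ dist (q i) (y m))
    (hsep : ∀ i l : Fin k, i ≠ l → 9 / 10 ≤ dist (q i) (q l))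
    (w : ℝ → ℝ) (hw : ∀ t : ℝ, 9 / 10 ≤ t → lennardJones t ≤ -w t)
    (hcount : 2 * ((98309653 / 125000000 : ℝ) * k + 1 / 100) ≤
      2 * ∑ i : Fin k, ∑ m : Fin N, w (dist (q i) (y m)) + ∑ i : Fin k, ∑ l ∈ Finset.univ.erase i, w (dist (q i) (q l)))
    {m : Fin N} (hm : -(98309653 / 125000000 : ℝ) + 1 / 50 ≤ siteEnergy lennardJones y m) :
    k * (1 / 100 - siteEnergy lennardJones y m) + 1 / 50 ≤
      -(interactionEnergy lennardJones q + ∑ i : Fin k, ∑ l : Fin N, lennardJones (dist (q i) (y l))) := by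
  have hself := two_mul_interactionEnergy_le_neg_credit q w hw hsep
  have hcross := cross_le_neg_credit q y w hw hclear
  have hk' : (1 : ℝ) ≤ k := by exact_mod_cast hk
  have h1 : k * (1 / 100 - siteEnergy lennardJones y m) ≤ k * ((98309653 / 125000000 : ℝ) - 1 / 100) :=
    mul_le_mul_of_nonneg_left (by linarith) (by linarith)
  nlinarith

/-! ## §6 Where calibrators live: Kossel's half-environment principle -/

/-- **Every nonempty injective configuration has an ANTIPODAL-FREE particle (PROVED):** a particle `m` (any one farthest from the origin) such
that no two of its neighbour vectors are antipodal, `y l − y m ≠ −(y l' − y m)` for all `l, l' ≠ m` (parallelogram law: a point that is the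
midpoint of two other points of the configuration is not farthest). -/
theorem exists_antipodalFree (hN : 0 < N) (y : Fin N → E3) (hy : Function.Injective y) :
    ∃ m : Fin N, ∀ l l' : Fin N, l ≠ m → l' ≠ m → y l - y m ≠ -(y l' - y m) := by
  obtain ⟨m, -, hm⟩ := Finset.exists_max_image Finset.univ (fun i : Fin N => ‖y i‖) ⟨⟨0, hN⟩, Finset.mem_univ _⟩
  refine ⟨m, fun l l' hl _ h => ?_⟩
  -- `y l + y l' = 2 • y m`
  have hsum : y l + y l' = (2 : ℝ) • y m := by
    have : y l - y m + (y l' - y m) = 0 := by rw [h]; abel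
    have h2 : y l + y l' - (2 : ℝ) • y m = 0 := by rw [two_smul]; rw [← this]; abel
    exact sub_eq_zero.1 h2
  have hpar := parallelogram_law_with_norm ℝ (y l) (y l')
  have hl1 := hm l (Finset.mem_univ _)
  have hl2 := hm l' (Finset.mem_univ _)
  rw [hsum, norm_smul, Real.norm_eq_abs, abs_of_pos (by norm_num : (0 : ℝ) < 2)] at hpar
  -- `‖y l − y l'‖² = 2‖y l‖² + 2‖y l'‖² − 4‖y m‖² ≤ 0`
  have hsq1 : ‖y l‖ * ‖y l‖ ≤ ‖y m‖ * ‖y m‖ := mul_self_le_mul_self (norm_nonneg _) hl1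
  have hsq2 : ‖y l'‖ * ‖y l'‖ ≤ ‖y m‖ * ‖y m‖ := mul_self_le_mul_self (norm_nonneg _) hl2
  have hzero : ‖y l - y l'‖ * ‖y l - y l'‖ ≤ 0 := by nlinarith
  have heq : y l = y l' := by
    have : ‖y l - y l'‖ = 0 := by nlinarith [norm_nonneg (y l - y l')]
    exact sub_eq_zero.1 (norm_eq_zero.1 this)
  -- then `y l − y m = −(y l − y m)` forces `y l = y m`
  rw [← heq] at h
  have : y l - y m = 0 := by
    have h2 : (2 : ℝ) • (y l - y m) = 0 := by rw [two_smul]; nth_rewrite 2 [h]; abel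
    exact (smul_eq_zero.1 h2).resolve_left (by norm_num)
  exact hl (hy (sub_eq_zero.1 this))

/-- **The antipodal-free half (PROVED, pure bookkeeping):** in a centrosymmetric finite set `T` of vectors of length `≥ 9/10`, an
antipodal-free subset `S` carries at least HALF of the (non-positive) total: `(1/2)·Σ_{v ∈ T} V(|v|) ≤ Σ_{v ∈ S} V(|v|)`
(`S` and its reflection `−S` are disjoint inside `T`, carry the same sum, and the rest of `T` is `≤ 0`). -/
theorem half_sum_le_of_antipodalFree {T S : Finset E3} (hT : ∀ v ∈ T, -v ∈ T) (hTfar : ∀ v ∈ T, 9 / 10 ≤ ‖v‖)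
    (hST : S ⊆ T) (hS : ∀ v ∈ S, -v ∉ S) :
    (1 / 2) * ∑ v ∈ T, lennardJones ‖v‖ ≤ ∑ v ∈ S, lennardJones ‖v‖ := by
  -- `V_LJ ≤ 0` from `9/10` on, read off the landed window bound (the tree's `lennardJones_nonpos_of_ge_nine_tenths` of
  -- `PhononSlackCertificatesNearFarGlueRHcpBoxSubset` lies outside this file's import closure)
  have lennardJones_nonpos_of_ge : ∀ {r : ℝ}, 9 / 10 ≤ r → lennardJones r ≤ 0 := by
    intro r hr
    have h := sum_lennardJones_le_window_card ({(0 : Fin 1)} : Finset (Fin 1)) (fun _ => r) (fun _ _ => hr)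
    have hc : (0 : ℝ) ≤ (({(0 : Fin 1)} : Finset (Fin 1)).filter fun l => 39 / 40 ≤ (fun _ : Fin 1 => r) l ∧
        (fun _ : Fin 1 => r) l ≤ 103 / 100).card := by positivity
    simp only [Finset.sum_singleton] at h
    linarith
  set S' : Finset E3 := S.image fun v => -v with hS'
  have hS'T : S' ⊆ T := by
    intro w hw
    rw [hS', Finset.mem_image] at hw
    obtain ⟨v, hv, rfl⟩ := hw
    exact hT v (hST hv)
  have hdisj : Disjoint S S' := by
    rw [Finset.disjoint_left]
    intro w hw hw'
    rw [hS', Finset.mem_image] at hw'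
    obtain ⟨v, hv, rfl⟩ := hw'
    exact hS v hv hw
  have hsumS' : ∑ w ∈ S', lennardJones ‖w‖ = ∑ v ∈ S, lennardJones ‖v‖ := by
    rw [hS', Finset.sum_image (fun v _ v' _ h => neg_injective h)]
    simp only [norm_neg]
  have hunion : S ∪ S' ⊆ T := Finset.union_subset hST hS'T
  have hle : ∑ v ∈ T, lennardJones ‖v‖ ≤ ∑ v ∈ S ∪ S', lennardJones ‖v‖ :=
    Finset.sum_le_sum_of_subset_of_nonpos' hunion fun v hv _ => lennardJones_nonpos_of_ge (hTfar v hv)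
  rw [Finset.sum_union hdisj, hsumS'] at hle
  linarith

/-- **KOSSEL'S HALF-ENVIRONMENT PRINCIPLE (PROVED, GS-free):** if the neighbour vectors of the particle `m` all lie in a centrosymmetric finite
set `T` of vectors of length `≥ 9/10` and no two of them are antipodal, then `m` binds at most HALF of the centre of `T`:
`(1/2)·Σ_{v ∈ T} V(|v|) ≤ 𝓔^m(y)`.  (A convex-hull vertex of a host-lattice patch binds at most the half-crystal value `|e_loc|`.) -/
theorem half_le_siteEnergy_of_antipodalFree {y : Fin N → E3} (hy : Function.Injective y) (m : Fin N) (T : Finset E3)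
    (hT : ∀ v ∈ T, -v ∈ T) (hTfar : ∀ v ∈ T, 9 / 10 ≤ ‖v‖)
    (henv : ∀ l : Fin N, l ≠ m → y l - y m ∈ T)
    (hanti : ∀ l l' : Fin N, l ≠ m → l' ≠ m → y l - y m ≠ -(y l' - y m)) :
    (1 / 2) * ∑ v ∈ T, lennardJones ‖v‖ ≤ siteEnergy lennardJones y m := by
  set S : Finset E3 := (Finset.univ.erase m).image fun l => y l - y m with hS
  have hinjv : Set.InjOn (fun l => y l - y m) ↑(Finset.univ.erase m) := by
    intro l _ l' _ h
    exact hy (sub_left_injective h)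
  have hsite : siteEnergy lennardJones y m = ∑ v ∈ S, lennardJones ‖v‖ := by
    unfold siteEnergy
    rw [hS, Finset.sum_image hinjv]
    refine Finset.sum_congr rfl fun l _ => ?_
    rw [dist_eq_norm, ← norm_neg, neg_sub]
  have hST : S ⊆ T := by
    intro v hv
    rw [hS, Finset.mem_image] at hv
    obtain ⟨l, hl, rfl⟩ := hv
    exact henv l (Finset.ne_of_mem_erase hl)
  have hSanti : ∀ v ∈ S, -v ∉ S := by
    intro v hv hv'
    rw [hS, Finset.mem_image] at hv hv'
    obtain ⟨l', hl', rfl⟩ := hv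
    obtain ⟨l, hl, hle⟩ := hv'
    exact hanti l l' (Finset.ne_of_mem_erase hl) (Finset.ne_of_mem_erase hl') hle
  rw [hsite]
  exact half_sum_le_of_antipodalFree hT hTfar hST hSanti

/-- **KOSSEL'S PRINCIPLE AT FINITE RANGE (PROVED, GS-free):** at a `7/10`-separated injective configuration, if the neighbour vectors of `m`
WITHIN RANGE `ρ ≥ 1` lie antipodal-free in a centrosymmetric `T` (lengths `≥ 9/10`), then `(1/2)·Σ_{v ∈ T} V(|v|) − tailE ρ ≤ 𝓔^m(y)`
— the far field costs at most the landed energy tail `tailE ρ = 72·(10/7)³·ρ⁻³` (`LoopTunnelDialRangeTails.sum_far_abs_lennardJones_le`). -/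
theorem half_sub_tail_le_siteEnergy_of_antipodalFree_near {y : Fin N → E3} (hy : Function.Injective y)
    (hsep : ∀ i j : Fin N, i ≠ j → (7 : ℝ) / 10 ≤ dist (y i) (y j)) (m : Fin N) {ρ : ℝ} (hρ : 1 ≤ ρ)
    (T : Finset E3) (hT : ∀ v ∈ T, -v ∈ T) (hTfar : ∀ v ∈ T, 9 / 10 ≤ ‖v‖)
    (henv : ∀ l : Fin N, l ≠ m → dist (y m) (y l) ≤ ρ → y l - y m ∈ T)
    (hanti : ∀ l l' : Fin N, l ≠ m → l' ≠ m → dist (y m) (y l) ≤ ρ → dist (y m) (y l') ≤ ρ →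
      y l - y m ≠ -(y l' - y m)) :
    (1 / 2) * ∑ v ∈ T, lennardJones ‖v‖ - tailE ρ ≤ siteEnergy lennardJones y m := by
  have hsplit : siteEnergy lennardJones y m =
      ∑ l ∈ nearIdx ρ y m, lennardJones (dist (y m) (y l)) + ∑ l ∈ farIdx ρ y m, lennardJones (dist (y m) (y l)) := by
    unfold siteEnergy
    exact sum_erase_eq_near_add_far ρ y m _
  -- far part `≥ −tailE ρ`
  have hfar : -tailE ρ ≤ ∑ l ∈ farIdx ρ y m, lennardJones (dist (y m) (y l)) := by
    have h := sum_far_abs_lennardJones_le hy hsep m hρ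
    have h' : -(∑ l ∈ farIdx ρ y m, |lennardJones (dist (y m) (y l))|) ≤
        ∑ l ∈ farIdx ρ y m, lennardJones (dist (y m) (y l)) := by
      rw [← Finset.sum_neg_distrib]
      exact Finset.sum_le_sum fun l _ => neg_abs_le _
    linarith
  -- near part `≥ (1/2) Σ_T`
  set S : Finset E3 := (nearIdx ρ y m).image fun l => y l - y m with hS
  have hinjv : Set.InjOn (fun l => y l - y m) ↑(nearIdx ρ y m) := by
    intro l _ l' _ h
    exact hy (sub_left_injective h)
  have hmem : ∀ l ∈ nearIdx ρ y m, l ≠ m ∧ dist (y m) (y l) ≤ ρ := fun l hl => by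
    have h := Finset.mem_filter.1 hl
    exact ⟨Finset.ne_of_mem_erase h.1, h.2⟩
  have hnear : ∑ l ∈ nearIdx ρ y m, lennardJones (dist (y m) (y l)) = ∑ v ∈ S, lennardJones ‖v‖ := by
    rw [hS, Finset.sum_image hinjv]
    refine Finset.sum_congr rfl fun l _ => ?_
    rw [dist_eq_norm, ← norm_neg, neg_sub]
  have hST : S ⊆ T := by
    intro v hv
    rw [hS, Finset.mem_image] at hv
    obtain ⟨l, hl, rfl⟩ := hv
    exact henv l (hmem l hl).1 (hmem l hl).2
  have hSanti : ∀ v ∈ S, -v ∉ S := by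
    intro v hv hv'
    rw [hS, Finset.mem_image] at hv hv'
    obtain ⟨l', hl', rfl⟩ := hv
    obtain ⟨l, hl, hle⟩ := hv'
    exact hanti l l' (hmem l hl).1 (hmem l' hl').1 (hmem l hl).2 (hmem l' hl').2 hle
  have hcore := half_sum_le_of_antipodalFree hT hTfar hST hSanti
  rw [hsplit, hnear]
  linarith

end Summit.AtomisticToContinuum.Crystallization.Theorems.LoopTunnelDialCalibratorRung

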